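import Mathlib
import Literature.Topology.FourManifolds.Cobordism
import Literature.Topology.FourManifolds.OpenCollar
import Literature.Topology.FourManifolds.OpenCollarExistence

/-!
# The interior of a compact connected manifold with boundary is preconnected

Stub `stub_interiorConnected` of the line `einstein-bulk-transfer` of the crux
`InformationMetricHadamard.AhHadamardFilling`: for a compact connected smooth `5`-manifold with
boundary `X` (model `𝓡∂ 5`), the interior `(𝓡∂ 5).interior X` is preconnected.

Proof: a dense subset `A` of a connected space such that every point of the space has an open
neighbourhood `W` with `W ∩ A` preconnected is itself preconnected (point-set lemma
`isPreconnected_of_dense_of_forall_exists_nhd`).  For `A = int X` density and the neighbourhoods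
at boundary points come from a long open collar `toFun : ∂X × [0, ∞) → X` of the boundary
(tree `BoundaryData.nonempty_openCollar`, `nonempty_boundaryData_holds`): `incl y` is the limit of
the interior points `toFun y t`, `t → 0⁺`, and `region ∩ proj ⁻¹' B`, `B` the component of `proj z`
in `∂X`, is an open neighbourhood of `z ∈ region` meeting `int X` in the continuous image of the
connected set `B × (0, ∞)`; at points off the collar region (interior points) the component of the
point in the open set `int X` does it (manifolds are locally connected).
-/

noncomputable section

set_option linter.dupNamespace false

open scoped Manifold ContDiff Topology
open Set Function Bundle Filter

namespace Summit.SmoothPoincare4.SmoothPoincare4.Cruxes.AhHadamardFilling.EinsteinBulkTransfer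

open Literature.Topology.FourManifolds

/-! ### A point-set lemma -/

/-- A dense subset `A` of a preconnected space, such that every point of the space has an open
neighbourhood `W` with `W ∩ A` preconnected, is preconnected: for a separation `A ⊆ u ∪ v` the sets
of points having such a `W` with `W ∩ A ⊆ u`, resp. `⊆ v`, are open, cover, and are disjoint by
density. [folklore] -/
theorem isPreconnected_of_dense_of_forall_exists_nhd {α : Type*} [TopologicalSpace α]
    [PreconnectedSpace α] {A : Set α} (hd : Dense A)
    (hl : ∀ x : α, ∃ W : Set α, IsOpen W ∧ x ∈ W ∧ IsPreconnected (W ∩ A)) :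
    IsPreconnected A := by
  rw [isPreconnected_iff_subset_of_disjoint]
  intro u v hu hv hAuv hA
  set P : Set α := {x | ∃ W : Set α, IsOpen W ∧ x ∈ W ∧ W ∩ A ⊆ u} with hP
  set Q : Set α := {x | ∃ W : Set α, IsOpen W ∧ x ∈ W ∧ W ∩ A ⊆ v} with hQ
  have hPo : IsOpen P := isOpen_iff_forall_mem_open.2 fun x ⟨W, hW, hxW, hWu⟩ =>
    ⟨W, fun y hy => ⟨W, hW, hy, hWu⟩, hW, hxW⟩
  have hQo : IsOpen Q := isOpen_iff_forall_mem_open.2 fun x ⟨W, hW, hxW, hWv⟩ =>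
    ⟨W, fun y hy => ⟨W, hW, hy, hWv⟩, hW, hxW⟩
  have hPQ : ∀ x, x ∈ P ∨ x ∈ Q := by
    intro x
    obtain ⟨W, hW, hxW, hWA⟩ := hl x
    have hsub : W ∩ A ⊆ u ∪ v := inter_subset_right.trans hAuv
    have hdisj : W ∩ A ∩ (u ∩ v) = ∅ :=
      subset_eq_empty (inter_subset_inter_left _ inter_subset_right) hA
    rcases (isPreconnected_iff_subset_of_disjoint.1 hWA) u v hu hv hsub hdisj with h | h
    · exact Or.inl ⟨W, hW, hxW, h⟩
    · exact Or.inr ⟨W, hW, hxW, h⟩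
  have hdis : ∀ x, x ∈ P → x ∈ Q → False := by
    rintro x ⟨W₁, hW₁, hxW₁, h₁⟩ ⟨W₂, hW₂, hxW₂, h₂⟩
    obtain ⟨a, haW, haA⟩ := hd.inter_open_nonempty (W₁ ∩ W₂) (hW₁.inter hW₂) ⟨x, hxW₁, hxW₂⟩
    have : a ∈ A ∩ (u ∩ v) := ⟨haA, h₁ ⟨haW.1, haA⟩, h₂ ⟨haW.2, haA⟩⟩
    rw [hA] at this
    exact this
  have hPQ' : Pᶜ = Q := by
    ext x
    exact ⟨fun hx => (hPQ x).resolve_left hx, fun hx hxP => hdis x hxP hx⟩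
  have hPc : IsClopen P := ⟨⟨by rw [hPQ']; exact hQo⟩, hPo⟩
  rcases isClopen_iff.1 hPc with hP0 | hP1
  · right
    intro a haA
    have haQ : a ∈ Q := by
      rw [← hPQ', hP0, compl_empty]
      exact mem_univ a
    obtain ⟨W, -, haW, hWv⟩ := haQ
    exact hWv ⟨haW, haA⟩
  · left
    intro a haA
    have haP : a ∈ P := by
      rw [hP1]
      exact mem_univ a
    obtain ⟨W, -, haW, hWu⟩ := haP
    exact hWu ⟨haW, haA⟩

/-! ### Collar neighbourhoods of boundary points -/

section Collar

variable {n : ℕ} {M : Type} [TopologicalSpace M] [ChartedSpace (EuclideanHalfSpace (n + 1)) M]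
  {b : BoundaryData (𝓡∂ (n + 1)) M (𝓡 n)}

/-- Along a long open collar, every point of `M` is in the closure of the interior: a boundary
point `incl y = toFun y 0` is the limit of the interior points `toFun y t`, `t → 0⁺`. [folklore] -/
theorem dense_interior_of_openCollar (D : b.OpenCollar) : Dense ((𝓡∂ (n + 1)).interior M) := by
  intro z
  rcases (𝓡∂ (n + 1)).isInteriorPoint_or_isBoundaryPoint z with hz | hz
  · exact subset_closure hz
  · have hz' : z ∈ (𝓡∂ (n + 1)).boundary M := hz
    rw [← b.range_incl] at hz'
    obtain ⟨y, rfl⟩ := hz'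
    have hcont : ContinuousOn (fun t : ℝ => D.toFun y t) (Ici 0) :=
      D.continuousOn_toFun.comp (continuousOn_const.prodMk continuousOn_id)
        fun t ht => ⟨mem_univ _, ht⟩
    have htend : Tendsto (fun t : ℝ => D.toFun y t) (𝓝[>] (0 : ℝ)) (𝓝 (b.incl y)) := by
      rw [← D.apply_zero y]
      exact ((hcont 0 (mem_Ici.2 le_rfl)).tendsto).mono_left
        (nhdsWithin_mono _ Ioi_subset_Ici_self)
    refine mem_closure_of_tendsto htend ?_
    filter_upwards [self_mem_nhdsWithin] with t ht
    exact D.isInteriorPoint_apply y ht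

/-- Along a long open collar, for `z ∈ region` the set `region ∩ proj ⁻¹' B`, `B` the connected
component of `proj z` in `∂M`, is an open neighbourhood of `z` meeting the interior of `M` in the
preconnected set `toFun '' (B × (0, ∞))`. [folklore] -/
theorem exists_nhd_inter_interior_of_mem_region (D : b.OpenCollar) {z : M} (hz : z ∈ D.region) :
    ∃ W : Set M, IsOpen W ∧ z ∈ W ∧ IsPreconnected (W ∩ (𝓡∂ (n + 1)).interior M) := by
  haveI : LocallyConnectedSpace b.carrier :=
    ChartedSpace.locallyConnectedSpace (EuclideanSpace ℝ (Fin n)) b.carrier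
  set B : Set b.carrier := connectedComponent (D.proj z) with hB
  refine ⟨D.region ∩ D.proj ⁻¹' B,
    D.continuousOn_proj.isOpen_inter_preimage D.isOpen_region isOpen_connectedComponent,
    ⟨hz, mem_connectedComponent⟩, ?_⟩
  have himage : D.region ∩ D.proj ⁻¹' B ∩ (𝓡∂ (n + 1)).interior M =
      uncurry D.toFun '' (B ×ˢ Ioi (0 : ℝ)) := by
    ext w
    constructor
    · rintro ⟨⟨hw, hwB⟩, hwi⟩
      refine ⟨(D.proj w, D.height w), ⟨hwB, D.height_pos_of_isInteriorPoint hw hwi⟩, ?_⟩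
      exact D.apply_proj_height w hw
    · rintro ⟨⟨x, t⟩, ⟨hxB, ht⟩, rfl⟩
      have ht' : (0 : ℝ) ≤ t := le_of_lt ht
      refine ⟨⟨D.mem_region x t ht', ?_⟩, D.isInteriorPoint_apply x ht⟩
      show D.proj (D.toFun x t) ∈ B
      rw [D.proj_apply x t ht']
      exact hxB
  rw [himage]
  exact (isPreconnected_connectedComponent.prod isPreconnected_Ioi).image _
    (D.continuousOn_toFun.mono (prod_mono (subset_univ _) Ioi_subset_Ici_self))

/-- Along a long open collar of a smooth manifold with boundary, every point `z` of `M` has an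
open neighbourhood `W` with `W ∩ int M` preconnected: on `region` the collar neighbourhood, off
`region` (interior points) the component of `z` in the open set `int M` (manifolds are locally
connected). [folklore] -/
theorem exists_nhd_inter_interior [IsManifold (𝓡∂ (n + 1)) ∞ M] (D : b.OpenCollar) (z : M) :
    ∃ W : Set M, IsOpen W ∧ z ∈ W ∧ IsPreconnected (W ∩ (𝓡∂ (n + 1)).interior M) := by
  by_cases hz : z ∈ D.region
  · exact exists_nhd_inter_interior_of_mem_region D hz
  · haveI : LocallyConnectedSpace M :=
      ChartedSpace.locallyConnectedSpace (EuclideanHalfSpace (n + 1)) M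
    have hzi : z ∈ (𝓡∂ (n + 1)).interior M := D.isInteriorPoint_of_not_mem_region hz
    have hopen : IsOpen ((𝓡∂ (n + 1)).interior M) :=
      ModelWithCorners.isOpen_interior (I := 𝓡∂ (n + 1)) (M := M) (n := ∞) (by simp)
    refine ⟨connectedComponentIn ((𝓡∂ (n + 1)).interior M) z, hopen.connectedComponentIn,
      mem_connectedComponentIn hzi, ?_⟩
    rw [inter_eq_left.2 (connectedComponentIn_subset _ _)]
    exact isPreconnected_connectedComponentIn

end Collar

/-! ### The stub -/

/-- **The interior of a compact connected manifold with boundary is preconnected** (a boundary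
point has collar neighbourhoods whose interior parts are connected; tree
`BoundaryData.nonempty_openCollar`, `nonempty_boundaryData_holds`). [folklore] -/
theorem stub_interiorConnected
    (X : Type) [TopologicalSpace X] [T2Space X] [SecondCountableTopology X]
    [ChartedSpace (EuclideanHalfSpace 5) X] [IsManifold (𝓡∂ 5) ∞ X] [CompactSpace X]
    [ConnectedSpace X] :
    IsPreconnected ((𝓡∂ 5).interior X) := by
  rcases ((𝓡∂ 5).boundary X).eq_empty_or_nonempty with hb | hb
  · rw [← ModelWithCorners.compl_boundary, hb, compl_empty]
    exact isPreconnected_univ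
  obtain ⟨b⟩ := nonempty_boundaryData_holds 4 X
  haveI : Nonempty b.carrier := by
    obtain ⟨z, hz⟩ := hb
    rw [← b.range_incl] at hz
    obtain ⟨y, -⟩ := hz
    exact ⟨y⟩
  obtain ⟨D⟩ := b.nonempty_openCollar
  exact isPreconnected_of_dense_of_forall_exists_nhd (dense_interior_of_openCollar D)
    (exists_nhd_inter_interior D)

end Summit.SmoothPoincare4.SmoothPoincare4.Cruxes.AhHadamardFilling.EinsteinBulkTransfer
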